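import Literature.Dynamics.Ergodic.KolmogorovSinaiEntropyLemmas
import Mathlib.MeasureTheory.Function.ConditionalExpectation.CondJensen

/-!
# Kolmogorov–Sinai entropy: static inequalities (Walters Thm 4.3)

Companion to `Literature/Dynamics/Ergodic/KolmogorovSinaiEntropy.lean` (definitions and
conventions there) and `…Lemmas.lean` (pointwise/a.e. lemmas). Everything in this file is
PROVED. For a finite measure `μ` on `Ω`, finite partitions `ξ : Ω → α`, `η : Ω → β` (maps into
finite types) and sub-σ-algebras `m, m₁, m₂` we prove the items of Walters, *An Introduction to
Ergodic Theory*, Thm 4.3 that do not involve the chain rule, in the general form of Remark 2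
after Thm 4.7 (arbitrary conditioning σ-algebra):

* (iii)/(iv) monotonicity under refinement: `H(f ∘ ξ | m) ≤ H(ξ | m)`, `H(f ∘ ξ) ≤ H(ξ)`
  (`condPartitionEntropy_comp_le`, `partitionEntropy_comp_le`) — a partition coarser than `ξ`
  is exactly one of the form `f ∘ ξ`;
* (v)/(vi) monotonicity in the condition: `m₁ ≤ m₂ → H(ξ | m₂) ≤ H(ξ | m₁)` and
  `H(ξ | m) ≤ H(ξ)` (`condPartitionEntropy_antitone`, `condPartitionEntropy_le_partitionEntropy`)
  — by the conditional Jensen inequality for the concave `φ(x) = -x log x` (Mathlib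
  `ConcaveOn.condExp_map_le`) and the tower property, as in Parry, *Topics*, Ch. 2 §2, Cor. of
  Thm 4;
* (vii)/(viii) subadditivity: `H(ξ ∨ η | m) ≤ H(ξ | m) + H(η | m)`, `H(ξ ∨ η) ≤ H(ξ) + H(η)`
  (`condPartitionEntropy_prod_le_add`, `partitionEntropy_prod_le_add`) — pointwise in `ω` this
  is subadditivity of the Shannon entropy of the finite distribution
  `(a, b) ↦ μ[1_{ξ=a, η=b} | m](ω)` (`sum_negMulLog_le_sum_fst_add_sum_snd`, from
  `Literature.Probability.Entropy.FiniteShannon.ent_pair_le_add`);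
* (ix)/(x) invariance under measure-preserving maps `φ : (Ω, μ) → (Ω', μ')`:
  `H_μ(ξ ∘ φ | φ⁻¹ m') = H_{μ'}(ξ | m')`, `H_μ(ξ ∘ φ) = H_{μ'}(ξ)`
  (`condPartitionEntropy_comp_of_measurePreserving`,
  `partitionEntropy_comp_of_measurePreserving`), via the transport formula
  `μ[f ∘ φ | φ⁻¹m'] = μ'[f | m'] ∘ φ` a.e. (`condExp_comp_ae_eq_of_measurePreserving`).

Not here: the chain rule (i)/(ii) `H(ξ ∨ η | m) = H(ξ | m) + H(η | σ(ξ) ∨ m)` and Thms 4.4/4.8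
(cases of equality).

## References
* P. Walters, *An Introduction to Ergodic Theory*, GTM 79, Springer 1982, §4.3, Thm 4.3.
* W. Parry, *Topics in Ergodic Theory*, CUP 1981, Ch. 2 §2.
-/

noncomputable section

open MeasureTheory Filter Topology Function Real
open scoped ENNReal

namespace Literature.Dynamics.Ergodic

variable {Ω Ω' α β : Type*}

/-! ### Walters Thm 4.3 (iii)/(iv): monotonicity under refinement -/

section Refinement

variable [Fintype α] [Fintype β] {m : MeasurableSpace Ω} {mΩ : MeasurableSpace Ω}
  {μ : Measure Ω} [MeasurableSpace α] [MeasurableSingletonClass α]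

/-- **Walters Thm 4.3 (iii)**, partition form: a coarser partition has smaller conditional
entropy, `H(f ∘ ξ | m) ≤ H(ξ | m)` (`𝒜 ⊆ 𝒞 ⇒ H(𝒜/𝒟) ≤ H(𝒞/𝒟)`).
[cite: Walters1982, Thm 4.3 (iii)] -/
theorem condPartitionEntropy_comp_le [IsFiniteMeasure μ] {ξ : Ω → α} (hξ : Measurable ξ)
    (f : α → β) : condPartitionEntropy μ (f ∘ ξ) m ≤ condPartitionEntropy μ ξ m := by
  classical
  unfold condPartitionEntropy
  refine integral_mono_ae (integrable_sum_negMulLog_condExp _)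
    (integrable_sum_negMulLog_condExp _) ?_
  filter_upwards [ae_all_iff.2 fun b =>
      condExp_indicator_preimage_comp_singleton (μ := μ) (m := m) hξ f b,
    ae_all_iff.2 fun a => ae_condExp_indicator_mem_Icc (μ := μ) (ξ ⁻¹' {a}) m] with ω hω h01
  calc ∑ b, negMulLog ((μ[((f ∘ ξ) ⁻¹' {b}).indicator (fun _ => (1 : ℝ)) | m]) ω)
      = ∑ b, negMulLog (∑ a ∈ Finset.univ.filter (fun a => f a = b),
          (μ[(ξ ⁻¹' {a}).indicator (fun _ => (1 : ℝ)) | m]) ω) :=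
        Finset.sum_congr rfl fun b _ => by rw [hω b]
    _ ≤ ∑ b, ∑ a ∈ Finset.univ.filter (fun a => f a = b),
          negMulLog ((μ[(ξ ⁻¹' {a}).indicator (fun _ => (1 : ℝ)) | m]) ω) :=
        Finset.sum_le_sum fun b _ => negMulLog_sum_le _ fun a _ => (h01 a).1
    _ = ∑ a, negMulLog ((μ[(ξ ⁻¹' {a}).indicator (fun _ => (1 : ℝ)) | m]) ω) :=
        Finset.sum_fiberwise Finset.univ f _

omit [Fintype β] in
/-- **Walters Thm 4.3 (iv)**, partition form: `H(f ∘ ξ) ≤ H(ξ)` (`𝒜 ⊆ 𝒞 ⇒ H(𝒜) ≤ H(𝒞)`).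
[cite: Walters1982, Thm 4.3 (iv)] -/
theorem partitionEntropy_comp_le [Fintype β] [MeasurableSpace β] [MeasurableSingletonClass β]
    [IsProbabilityMeasure μ] {ξ : Ω → α} (hξ : Measurable ξ) (f : α → β) :
    partitionEntropy μ (f ∘ ξ) ≤ partitionEntropy μ ξ := by
  rw [← condPartitionEntropy_bot hξ,
    ← condPartitionEntropy_bot ((measurable_of_finite f).comp hξ)]
  exact condPartitionEntropy_comp_le hξ f

end Refinement

/-! ### Walters Thm 4.3 (v)/(vi): monotonicity in the condition (conditional Jensen) -/

section Condition

variable [Fintype α] {m m₁ m₂ : MeasurableSpace Ω} {mΩ : MeasurableSpace Ω} {μ : Measure Ω}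
  [IsFiniteMeasure μ]

omit [IsFiniteMeasure μ] in
/-- If `m` is not a sub-σ-algebra of the ambient one, `H(ξ | m) = 0` (Mathlib's `μ[·|m]` is then
`0`; junk value). [folklore] -/
theorem condPartitionEntropy_of_not_le (hm : ¬m ≤ mΩ) (ξ : Ω → α) :
    condPartitionEntropy μ ξ m = 0 := by
  simp [condPartitionEntropy, condExp_of_not_le hm]

/-- The Jensen step (Parry, Ch. 2 §2, Corollary of Thm 4): for `m₁ ⊆ m₂`,
`∫ φ(μ[1_s | m₂]) ≤ ∫ φ(μ[1_s | m₁])`, since `φ(μ[1_s|m₁]) = φ(E[μ[1_s|m₂] | m₁]) ≥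
E[φ(μ[1_s|m₂]) | m₁]` a.e. by concavity of `φ`. [cite: Walters1982, Thm 4.3 (v)] -/
theorem integral_negMulLog_condExp_antitone (hm₁₂ : m₁ ≤ m₂) (hm₂ : m₂ ≤ mΩ) (s : Set Ω) :
    ∫ ω, negMulLog ((μ[s.indicator (fun _ => (1 : ℝ)) | m₂]) ω) ∂μ ≤
      ∫ ω, negMulLog ((μ[s.indicator (fun _ => (1 : ℝ)) | m₁]) ω) ∂μ := by
  set g := μ[s.indicator (fun _ => (1 : ℝ)) | m₂] with hg
  have hm₁ : m₁ ≤ mΩ := hm₁₂.trans hm₂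
  have hJ : μ[negMulLog ∘ g | m₁] ≤ᵐ[μ] negMulLog ∘ μ[g | m₁] :=
    ConcaveOn.condExp_map_le (s := Set.Icc 0 1) hm₁
      (concaveOn_negMulLog.subset Set.Icc_subset_Ici_self (convex_Icc 0 1))
      (continuous_negMulLog.continuousOn.upperSemicontinuousOn)
      (ae_condExp_indicator_mem_Icc s m₂) isClosed_Icc integrable_condExp
      (integrable_negMulLog_condExp s)
  have hT : μ[g | m₁] =ᵐ[μ] μ[s.indicator (fun _ => (1 : ℝ)) | m₁] :=
    condExp_condExp_of_le hm₁₂ hm₂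
  have hT' : (negMulLog ∘ μ[g | m₁]) =ᵐ[μ]
      fun ω => negMulLog ((μ[s.indicator (fun _ => (1 : ℝ)) | m₁]) ω) :=
    hT.fun_comp negMulLog
  calc ∫ ω, negMulLog (g ω) ∂μ
      = ∫ ω, (μ[negMulLog ∘ g | m₁]) ω ∂μ := (integral_condExp hm₁).symm
    _ ≤ ∫ ω, (negMulLog ∘ μ[g | m₁]) ω ∂μ :=
        integral_mono_ae integrable_condExp ((integrable_negMulLog_condExp s).congr hT'.symm) hJ
    _ = ∫ ω, negMulLog ((μ[s.indicator (fun _ => (1 : ℝ)) | m₁]) ω) ∂μ :=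
        integral_congr_ae hT'

/-- **Walters Thm 4.3 (v)** (general conditioning σ-algebras, Remark 2 after Thm 4.7; Parry
Ch. 2 §2 Corollary): conditioning on more decreases entropy,
`m₁ ⊆ m₂ ⇒ H(ξ | m₂) ≤ H(ξ | m₁)`. [cite: Walters1982, Thm 4.3 (v)] -/
theorem condPartitionEntropy_antitone (hm₁₂ : m₁ ≤ m₂) (ξ : Ω → α) :
    condPartitionEntropy μ ξ m₂ ≤ condPartitionEntropy μ ξ m₁ := by
  by_cases hm₂ : m₂ ≤ mΩ
  · rw [condPartitionEntropy_eq_sum_integral, condPartitionEntropy_eq_sum_integral]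
    exact Finset.sum_le_sum fun a _ => integral_negMulLog_condExp_antitone hm₁₂ hm₂ _
  · rw [condPartitionEntropy_of_not_le hm₂]
    exact condPartitionEntropy_nonneg ξ m₁

/-- **Walters Thm 4.3 (vi)**: `H(ξ | m) ≤ H(ξ)`. [cite: Walters1982, Thm 4.3 (vi)] -/
theorem condPartitionEntropy_le_partitionEntropy [MeasurableSpace α] [MeasurableSingletonClass α]
    {μ : Measure Ω} [IsProbabilityMeasure μ] {ξ : Ω → α} (hξ : Measurable ξ)
    (m : MeasurableSpace Ω) : condPartitionEntropy μ ξ m ≤ partitionEntropy μ ξ := by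
  rw [← condPartitionEntropy_bot hξ]
  exact condPartitionEntropy_antitone bot_le ξ

end Condition

/-! ### Walters Thm 4.3 (vii)/(viii): subadditivity -/

section Subadditive

variable [Fintype α] [Fintype β] {m : MeasurableSpace Ω} {mΩ : MeasurableSpace Ω}
  {μ : Measure Ω} [MeasurableSpace α] [MeasurableSingletonClass α] [MeasurableSpace β]
  [MeasurableSingletonClass β]

/-- **Walters Thm 4.3 (vii)** (general conditioning σ-algebra): the join is subadditive,
`H(ξ ∨ η | m) ≤ H(ξ | m) + H(η | m)`. Pointwise in `ω` this is `H[X,Y] ≤ H[X] + H[Y]` for the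
probability vector `(a,b) ↦ μ[1_{ξ=a,η=b} | m](ω)`. [cite: Walters1982, Thm 4.3 (vii)] -/
theorem condPartitionEntropy_prod_le_add [IsFiniteMeasure μ] {ξ : Ω → α} {η : Ω → β}
    (hξ : Measurable ξ) (hη : Measurable η) :
    condPartitionEntropy μ (fun ω => (ξ ω, η ω)) m ≤
      condPartitionEntropy μ ξ m + condPartitionEntropy μ η m := by
  by_cases hm : m ≤ mΩ
  swap
  · rw [condPartitionEntropy_of_not_le hm, condPartitionEntropy_of_not_le hm,
      condPartitionEntropy_of_not_le hm, add_zero]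
  have hswap : ∀ (a : α) (b : β),
      (fun ω => (η ω, ξ ω)) ⁻¹' {(b, a)} = (fun ω => (ξ ω, η ω)) ⁻¹' {(a, b)} := by
    intro a b
    ext ω
    simp only [Set.mem_preimage, Set.mem_singleton_iff, Prod.mk.injEq, and_comm]
  unfold condPartitionEntropy
  rw [← integral_add (integrable_sum_negMulLog_condExp ξ) (integrable_sum_negMulLog_condExp η)]
  refine integral_mono_ae (integrable_sum_negMulLog_condExp _)
    ((integrable_sum_negMulLog_condExp ξ).add (integrable_sum_negMulLog_condExp η)) ?_
  filter_upwards [ae_all_iff.2 fun c =>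
      ae_condExp_indicator_mem_Icc (μ := μ) ((fun ω => (ξ ω, η ω)) ⁻¹' {c}) m,
    ae_sum_condExp_indicator_eq_one hm (hξ.prodMk hη),
    ae_all_iff.2 fun a => condExp_indicator_preimage_singleton_eq_sum_prod (m := m) hξ hη a,
    ae_all_iff.2 fun b => condExp_indicator_preimage_singleton_eq_sum_prod (m := m) hη hξ b]
    with ω h01 hsum hξa hηb
  have key := sum_negMulLog_le_sum_fst_add_sum_snd
    (p := fun c => (μ[((fun ω => (ξ ω, η ω)) ⁻¹' {c}).indicator (fun _ => (1 : ℝ)) | m]) ω)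
    (fun c => (h01 c).1) hsum
  refine key.trans_eq ?_
  congr 1
  · exact Finset.sum_congr rfl fun a _ => by rw [hξa a]
  · refine Finset.sum_congr rfl fun b _ => ?_
    rw [hηb b]
    simp only [hswap]

/-- **Walters Thm 4.3 (viii)**: `H(ξ ∨ η) ≤ H(ξ) + H(η)`. [cite: Walters1982, Thm 4.3 (viii)] -/
theorem partitionEntropy_prod_le_add [IsProbabilityMeasure μ] {ξ : Ω → α} {η : Ω → β}
    (hξ : Measurable ξ) (hη : Measurable η) :
    partitionEntropy μ (fun ω => (ξ ω, η ω)) ≤ partitionEntropy μ ξ + partitionEntropy μ η := by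
  rw [← condPartitionEntropy_bot hξ, ← condPartitionEntropy_bot hη,
    ← condPartitionEntropy_bot (hξ.prodMk hη)]
  exact condPartitionEntropy_prod_le_add hξ hη

end Subadditive

/-! ### Walters Thm 4.3 (ix)/(x): invariance under measure-preserving maps -/

section Transport

-- `m'` (a sub-σ-algebra of `Ω'`) is declared before the ambient `mΩ'` so that instance
-- resolution picks the ambient σ-algebras.
variable {m' : MeasurableSpace Ω'} {mΩ : MeasurableSpace Ω} {mΩ' : MeasurableSpace Ω'}
  {μ : Measure Ω} {μ' : Measure Ω'} {φ : Ω → Ω'}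

/-- **Walters Thm 4.3 (x)** (for a map between two spaces): `H_μ(ξ ∘ φ) = H_{μ'}(ξ)` for
measure-preserving `φ : (Ω, μ) → (Ω', μ')`; in particular `H(T⁻¹𝒜) = H(𝒜)`.
[cite: Walters1982, Thm 4.3 (x)] -/
theorem partitionEntropy_comp_of_measurePreserving [Fintype α] [MeasurableSpace α]
    [MeasurableSingletonClass α] (hφ : MeasurePreserving φ μ μ') {ξ : Ω' → α}
    (hξ : Measurable ξ) : partitionEntropy μ (ξ ∘ φ) = partitionEntropy μ' ξ := by
  unfold partitionEntropy
  refine Finset.sum_congr rfl fun a _ => ?_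
  rw [Set.preimage_comp,
    hφ.measureReal_preimage (hξ (measurableSet_singleton a)).nullMeasurableSet]

/-- Change of variables in set integrals over preimages under a measure-preserving map:
`∫_{φ⁻¹ s} g ∘ φ dμ = ∫_s g dμ'`. [folklore] -/
theorem setIntegral_comp_preimage_of_measurePreserving (hφ : MeasurePreserving φ μ μ')
    {s : Set Ω'} (hs : MeasurableSet s) {g : Ω' → ℝ} (hg : AEStronglyMeasurable g μ') :
    ∫ x in φ ⁻¹' s, g (φ x) ∂μ = ∫ y in s, g y ∂μ' := by
  have hres := hφ.restrict_preimage hs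
  calc ∫ x in φ ⁻¹' s, g (φ x) ∂μ
      = ∫ y, g y ∂(Measure.map φ (μ.restrict (φ ⁻¹' s))) :=
        (integral_map hres.measurable.aemeasurable (by rw [hres.map_eq]; exact hg.restrict)).symm
    _ = ∫ y in s, g y ∂μ' := by rw [hres.map_eq]

/-- **Transport of conditional expectations** along a measure-preserving map
`φ : (Ω, μ) → (Ω', μ')`: `E_μ[f ∘ φ | φ⁻¹m'] = E_{μ'}[f | m'] ∘ φ` a.e. (Parry: "property (vi)"
of Ch. 1 used for `I(ξ|𝒜) ∘ T = I(T⁻¹ξ | T⁻¹𝒜)`). [folklore] -/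
theorem condExp_comp_ae_eq_of_measurePreserving [IsFiniteMeasure μ] [IsFiniteMeasure μ']
    (hφ : MeasurePreserving φ μ μ') (hm' : m' ≤ mΩ') {f : Ω' → ℝ} (hf : Integrable f μ') :
    μ[f ∘ φ | m'.comap φ] =ᵐ[μ] μ'[f | m'] ∘ φ := by
  have hm : m'.comap φ ≤ mΩ := by
    rintro _ ⟨t, ht, rfl⟩
    exact hφ.measurable (hm' t ht)
  symm
  refine ae_eq_condExp_of_forall_setIntegral_eq hm
    ((hφ.integrable_comp hf.aestronglyMeasurable).2 hf) (fun s _ _ => ?_) ?_ ?_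
  · exact ((hφ.integrable_comp integrable_condExp.aestronglyMeasurable).2
      integrable_condExp).integrableOn
  · rintro _ ⟨s, hs, rfl⟩ -
    change ∫ x in φ ⁻¹' s, (μ'[f | m']) (φ x) ∂μ = ∫ x in φ ⁻¹' s, f (φ x) ∂μ
    rw [setIntegral_comp_preimage_of_measurePreserving hφ (hm' s hs)
        integrable_condExp.aestronglyMeasurable,
      setIntegral_comp_preimage_of_measurePreserving hφ (hm' s hs) hf.aestronglyMeasurable]
    exact setIntegral_condExp hm' hf hs
  · exact (stronglyMeasurable_condExp.comp_measurable (comap_measurable φ)).aestronglyMeasurable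

/-- **Walters Thm 4.3 (ix)** (for a map between two spaces; Parry Ch. 2 §2,
`H(ξ|𝒜) = H(T⁻¹ξ | T⁻¹𝒜)`): `H_μ(ξ ∘ φ | φ⁻¹m') = H_{μ'}(ξ | m')` for measure-preserving
`φ : (Ω, μ) → (Ω', μ')`. [cite: Walters1982, Thm 4.3 (ix)] -/
theorem condPartitionEntropy_comp_of_measurePreserving [Fintype α] [MeasurableSpace α]
    [MeasurableSingletonClass α] [IsFiniteMeasure μ] [IsFiniteMeasure μ']
    (hφ : MeasurePreserving φ μ μ') (hm' : m' ≤ mΩ') {ξ : Ω' → α} (hξ : Measurable ξ) :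
    condPartitionEntropy μ (ξ ∘ φ) (m'.comap φ) = condPartitionEntropy μ' ξ m' := by
  unfold condPartitionEntropy
  have hae : ∀ a : α,
      (fun ω => negMulLog
        ((μ[((ξ ∘ φ) ⁻¹' {a}).indicator (fun _ => (1 : ℝ)) | m'.comap φ]) ω)) =ᵐ[μ]
      fun ω => negMulLog ((μ'[(ξ ⁻¹' {a}).indicator (fun _ => (1 : ℝ)) | m']) (φ ω)) := by
    intro a
    have hind : ((ξ ∘ φ) ⁻¹' {a}).indicator (fun _ => (1 : ℝ)) =
        ((ξ ⁻¹' {a}).indicator (fun _ => (1 : ℝ))) ∘ φ := by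
      funext ω
      exact Set.indicator_comp_right (s := ξ ⁻¹' {a}) (g := fun _ => (1 : ℝ)) φ
    rw [hind]
    filter_upwards [condExp_comp_ae_eq_of_measurePreserving hφ hm'
      (integrable_indicator_preimage_singleton hξ a)] with ω hω
    rw [hω]
    rfl
  have hF : AEStronglyMeasurable
      (fun y => ∑ a, negMulLog ((μ'[(ξ ⁻¹' {a}).indicator (fun _ => (1 : ℝ)) | m']) y)) μ' :=
    (integrable_sum_negMulLog_condExp ξ).aestronglyMeasurable
  set F : Ω' → ℝ := fun y => ∑ a, negMulLog ((μ'[(ξ ⁻¹' {a}).indicator (fun _ => (1 : ℝ)) | m']) y)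
    with hFdef
  calc ∫ ω, ∑ a, negMulLog
          ((μ[((ξ ∘ φ) ⁻¹' {a}).indicator (fun _ => (1 : ℝ)) | m'.comap φ]) ω) ∂μ
      = ∫ ω, F (φ ω) ∂μ := by
        refine integral_congr_ae ?_
        filter_upwards [ae_all_iff.2 hae] with ω hω
        exact Finset.sum_congr rfl fun a _ => hω a
    _ = ∫ y, F y ∂(Measure.map φ μ) :=
        (integral_map hφ.measurable.aemeasurable (by rw [hφ.map_eq]; exact hF)).symm
    _ = ∫ y, F y ∂μ' := by rw [hφ.map_eq]

end Transport

end Literature.Dynamics.Ergodic
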